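import Summits.BirchSwinnertonDyer.BirchSwinnertonDyer.Theses.UniversalToricDescent
import Summits.BirchSwinnertonDyer.BirchSwinnertonDyer.Theorems.UniversalToricDescentThinCombDefs
import Summits.BirchSwinnertonDyer.BirchSwinnertonDyer.Theorems.UniversalToricDescentAdditiveSplitIMCInclusionAtThreeStubFrame
import Summits.BirchSwinnertonDyer.BirchSwinnertonDyer.Theorems.UniversalToricDescentAdditiveSplitIMCInclusionAtThreeStubCharIdealPrincipal
import Summits.BirchSwinnertonDyer.BirchSwinnertonDyer.Theorems.UniversalToricDescentAdditiveSplitIMCInclusionAtThreeStubWeakRigidity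
import Summits.BirchSwinnertonDyer.BirchSwinnertonDyer.Theorems.UniversalToricDescentAdditiveSplitIMCInclusionAtThreeStubDescent
import Summits.BirchSwinnertonDyer.BirchSwinnertonDyer.Theorems.UniversalToricDescentThinCombLineValue
import Summits.BirchSwinnertonDyer.BirchSwinnertonDyer.Theorems.SignedBaseChangeAnticyclotomicEisensteinDivisibilityXGrTwoModuleFinite
import Literature.NumberTheory.EllipticCurves.TwoVariableSelmerDual
import Literature.NumberTheory.EllipticCurves.ZpExtensionSplitPrimeLineThroughPair
import Literature.NumberTheory.EllipticCurves.ToricTwoVariablePAdicLFunction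
import Summits.BirchSwinnertonDyer.BirchSwinnertonDyer.Theorems.UniversalToricDescentBDPFrameCrossPeriodRigidity
import Summits.BirchSwinnertonDyer.BirchSwinnertonDyer.Theorems.UniversalToricDescentThinCombContRigidity
import Summits.BirchSwinnertonDyer.BirchSwinnertonDyer.Theorems.UniversalToricDescentCharIdealVacuity
import Summits.BirchSwinnertonDyer.BirchSwinnertonDyer.Theorems.UniversalToricDescentAdditiveSplitIMCInclusionAtThreeStubTorsionTransfer
import HarnessLib

/-!
# Line `thin_comb` — crux `AdditiveSplitIMCInclusionAtThree` (stmt-BirchSwinnertonDyer-20395, THE WALL, UTD r201)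
# skeleton of crux idea `thin-comb-reflection` (utd-idea g38/g40; lead cruxlead-20395 g2 request «Lines/thin_comb.lean,
# integral door»), pen bsd-wall-pss3x g7, 2026-08-29; v2 RESHAPED by the lead g2 (frame normalisation + weak reflection);
# v3 RESHAPED by the lead g3 (no-pseudo-null input of the descent made a registered stub); v4 (= pen v4.2) ADOPTED and
# REGISTERED by the lead g3 (research stub split along the landed predicate `IsToricTwoVarLFunction`); v5 RESHAPED by the
# lead g3 (landed stubs cited BY NAME; K3 split into K3a/K3b/K3c after utd-idea g46's S-g46-2, composition of K3 kernel-checked);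
# v6 RESHAPED by the lead g4 (K3c ELIMINATED: junk dichotomy + R∞ on values, `…Theorems.UniversalToricDescentThinCombContRigidity`);
# v7 RESHAPED by the lead g4 (TORSION DICHOTOMY: `X₂` torsion leaves the research stub; non-torsion branch = transfer stub + vacuity);
# v8 (lead g5): the transfer stub is PROVED (`…Theorems.UniversalToricDescentThinCombLine.stub_torsionTransfer`) and cited by name.

FRAME (the lead's and the card's currency, `Theorems/UniversalToricDescentThinCombDefs.lean`): `Λ₂(𝒪) = 𝒪⟦T₂⟧⟦T₁⟧`
(`PowerSeries (PowerSeries 𝒪)`, OUTER `T₁`, INNER `T₂`), `𝒪 = R₀ = unrIntegers 3`; a (𝔭, 𝔭′)-FRAME of the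
`ℤ₃²`-tower of `K` is a generator pair `(κ₁, κ₂; γ₁, γ₂)` (`ZpExtension.IsTopGeneratorPair`) with `κ₁` unramified
outside `𝔭`, `κ₂` unramified outside `𝔭′` (so `1 + T₁ ↔ γ₁ = γ_𝔭`, `1 + T₂ ↔ γ₂ = γ_𝔭′`), through which the crux's
anticyclotomic `κ` factors (`pairKer κ₁ κ₂ ≤ ker κ`) with `γ₁γ₂ ∈ ker κ` (the anticyclotomic line is
`(1 + T₁)(1 + T₂) = 1`, the ideal `𝔞` below) and `γ₂ ≡ γ (mod ker κ)` (on that line `1 + T₂ ↔ γ`, the crux's generator,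
so a one-variable series `L(T)` is read as `C L = L(T₂)`); `G` = the image in `Λ₂(R₀)` of a generator `g` of
`ch_{Λ₂}(X₂)`, `X₂ = XGr₂ (W.baseChange K) 3 κ₁ κ₂ 𝔭′ γ₁ γ₂ = X_{∅ at 𝔭, nr at 𝔭′}(E/K̃_∞)` (tree carrier, PINNED).

STUBS (v1 list; current list at the end of this docstring) (6): `stub_frame` (support: the frame exists), `stub_charIdealPrincipal` (support: `ch_{Λ₂}` is principal),
`stub_algFE` (K4, support-in-print: Nekovář 2006 duality + `c`-transport — `ρ G ∼ G` for a reflection `ρ`),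
`stub_twoVarCombSupply` (K2⁺ ⊕ K3, THE research stub: a `ρ`-symmetric two-variable function `L₂` congruent to
`u·L(T₂)` mod `𝔞`, with INTEGRAL thin-comb divisibility `ThinCombDvdInt R₀ 3 G L₂`, and `X₂` torsion),
`stub_rigidity` (K1 = `CombReflectionRigidityInt R₀ 3`, PROVED by the lead, closes by name when
`…ThinCombRigidity.lean` lands), `stub_descent` (S2: `G ∣ L₂` + the congruence ⟹ the crux's inclusion on the
anticyclotomic line: control `XGr₂ ↠ XAc`, no pseudo-null submodule, Delbourgo/Herbrand specialisation along `𝔞`,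
generator-congruence transport `γ₂ ≡ γ`). Composition `AdditiveSplitIMCInclusionAtThree_of` is kernel-checked.
BSD is not proved by any of this; every `stub_*` is `sorry`.

v2 (lead cruxlead-20395 g2, 2026-08-29, RESHAPE after `stub-misstated: stub_frame`). The v1 frame asked the two
split-prime lines (`κ₁` unramified outside `𝔭`, `κ₂` unramified outside `𝔭′`) to form a GENERATOR PAIR with
`κ(γ₁) = −1`, `κ(γ₂) = 1`. That is false whenever the first layer of the anticyclotomic `ℤ₃`-extension is unramified
(equivalently lies in the Hilbert class field; e.g. `K = ℚ(√−23)`, `3` split, `h_K = 3`): then the `𝔭`-line, the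
`𝔭′`-line and `κ` all have the SAME first layer, so no two of them are part of a `ℤ₃`-basis of `Hom(Γ, ℤ₃)`. v2 keeps
ONLY what the mechanism needs: `κ₁` = the `𝔭`-line (so `1 + T₂ ↔ γ₂` spans the saturated `𝔭′`-inertia line: the
comb is VERTICAL and the axis `T₂ = 0` is the CM family `𝛉^{(𝔭)}`), `κ₂` ANY complement, normalised by
`κ(γ₁) = 1` (so `1 + T₁ ↦ 1 + T` on the anticyclotomic line, `T = γ − 1` the crux's variable) and `κ(γ₂) = 3^k`
for some `k : ℕ` (`k = 0` iff the good case); the anticyclotomic line is the ideal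
`𝔞_k = (T₂ − ((1+T₁)^{3^k} − 1))`. The reflection `c∘ι` is then in general NOT an `IsReflection`; the lead's
Part VII theorem `UniversalToricDescentThinComb.dvd_of_weakReflection` needs only a WEAK reflection (fixes constants,
`ρ T₂ ∉ (3, T₂)` — true for `c∘ι` since `cγ₂c` spans the `𝔭`-inertia line `≠` the `𝔭′`-line), so `stub_rigidity`
becomes `stub_weakRigidity` (closed by name by that theorem) and K4 (`ρ G ∼ G`, in print: Nekovář + `c`-transport)
is folded into the research stub as a conjunct sharing the witness `ρ` with K3's `ρ L₂ ∼ L₂` (an un-pinned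
`∀ ρ weak → ρ L₂ ∼ L₂` would be false). Stubs v2 (5): `stub_frame`, `stub_charIdealPrincipal` (landed p692284),
`stub_twoVarCombSupply`, `stub_weakRigidity` (landed once Part VII p693012 is in the tree), `stub_descent`.
v3 (lead cruxlead-20395 g3, 2026-08-29, RESHAPE after `stub-misstated: stub_descent` (v2)). `stub_frame` v2 LANDED (p696267).
The v2 glue `stub_descent` asked for `(L) ⊆ ch_Λ(X_ac)·R₀⟦T⟧` from `G ∣ L₂`, `L₂ ≡ u·L(T₁) (mod 𝔞_k)`, finite
generation, torsion and `ch_{Λ₂}(X₂) = (g)` ALONE. That implication is not provable from its binders (and is a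
genuine arithmetic statement): with `L₂ := G`, `L := φ_k(G)` (`φ_k : Λ₂(R₀) ↠ R₀⟦T⟧`, `T₁ ↦ T`,
`1 + T₂ ↦ (1+T)^{3^k}`, kernel `𝔞_k`) all its hypotheses hold, and its conclusion `φ_k(g) ∈ ch_Λ(X_ac)` is, by the
Herbrand specialisation `ch_Λ(X₂/𝔞_k X₂) = ch_Λ(X₂[𝔞_k]) · φ_k(ch_{Λ₂} X₂)` and exact control `X₂/𝔞_k X₂ ≃ X_ac`,
EQUIVALENT to «`X₂[𝔞_k]` is `Λ`-pseudo-null (finite)» — the no-pseudo-null input of every printed two-variable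
descent (Greenberg 2016 Prop. 4.1.1; Skinner–Urban 2014 §3.2 / Cor. 3.2.9; the sibling line `bdpline` on
stmt-…-20727 carries it as `stub_noPseudoNullSS`). v3 makes it a registered stub: `stub_noPseudoNull` (support, in
print: every pseudo-null `Λ₂`-submodule of `X₂` is FINITE — Greenberg's «almost divisible», S3n′ shape of the tree's
`PrintCf2.TwoVarSpecializationFinite`) and `stub_descent` (v3) takes it as a hypothesis; nothing else changes.
Stubs v3 (6): `stub_frame` (landed p696267), `stub_charIdealPrincipal` (landed p692284), `stub_twoVarCombSupply`
(research), `stub_weakRigidity` (landed p694324), `stub_noPseudoNull` (NEW, support/print), `stub_descent` (v3, glue L).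

v4 PROPOSAL (pen bsd-wall-pss3x g7, 2026-08-29 05:3xZ — NOT registered; the lead adopts it by copying this file over
`Lines/thin_comb.lean` with the namespace renamed back to `…ThinComb` and re-running `ledger skeleton check`). D1 LANDED
(`defn-IsToricTwoVarLFunction`, p697787, `Literature/NumberTheory/EllipticCurves/ToricTwoVariablePAdicLFunction.lean`):
the research stub `stub_twoVarCombSupply` (K2⁺ ⊕ K3 ⊕ K4 with a SHARED ∃-witness `L₂`) is SPLIT along the predicate into
`stub_toricTwoVarL` (K3, ∃: a PINNED toric two-variable function for the crux's periods + the anticyclotomic comparison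
K3(ii)) and `stub_combDivisibility` (K2⁺ ⊕ K4, ∀ over PINNED `L₂`: torsion, the weak reflection with `ρ G ∼ G`,
`ρ L₂ ∼ L₂`, and `ThinCombDvdInt`) — «same `_of` modulo one binder» as announced on the line card (rev 3/4); landed stubs
and `stub_noPseudoNull` / `stub_descent` (v3) VERBATIM. Stubs v4 (7 = the cap): `stub_frame` (landed), `stub_charIdealPrincipal`
(landed), `stub_toricTwoVarL` (research ∃), `stub_combDivisibility` (research ∀), `stub_weakRigidity` (landed),
`stub_noPseudoNull` (print), `stub_descent` (v3 glue). If the lead wants K3(ii) as its own support stub (it is M–L from the D1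
API: `exists_hasValueAt₂_and_bdp` + one-variable identity principle along `𝔞_k` + substitution congruence), retire a landed
stub from the registered list to stay ≤ 7.
v4.1 (05:5xZ, utd-idea g45 AUDIT LENS-MEMO-UTD-IDEA-v45 §1 F1 / S-g45-1 ADOPTED verbatim = probe `Sketch-utd-idea-g45.lean`
4e0abeb665c9abfc): `stub_toricTwoVarL` concludes `∃ Ωp' ≠ 0, ∃ L₂, IsToricTwoVarLFunction … ΩK Ωp' L₂ ∧ (congruence)` and `_of`
feeds `Ωp'`, `hΩp'` to `stub_combDivisibility` (already `∀ ΩK Ωp L₂`); K3(ii) thereby carries the one-variable period-rigidity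
content (two BDP-admissible `(Ωp, L)` differ by `L ↦ (1+T)^c·L`, `(Ωp/Ωp')⁸ = w^c` — M–L, optional separate support stub);
F2 calibration: effective typed ranges at `p = 3` are `n` even (BDP) and `a, b` both even (toric).
v4.2 (06:1xZ, utd-idea g46 TURNKEY S-g46-1 ADOPTED verbatim = probe `Sketch-utd-idea-g46.lean` 31084e5f106b7c89): K3 DECOUPLED FROM
THE HANDED FRAME — `stub_toricTwoVarL` concludes `∃ (ΩK′ : ℂ) (Ωp′ : ℂ_[3]) (L₂ : Λ₂(R₀)) (L♮ : R₀⟦T⟧), ΩK′ ≠ 0 ∧ Ωp′ ≠ 0 ∧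
IsToricTwoVarLFunction … ΩK′ Ωp′ L₂ ∧ IsBDPLFunction ι′ 𝔭 κ γ Dt.f ΩK′ Ωp′ L♮ ∧ ∃ u : Λ₂ˣ, L₂ − u·L♮(T₁) ∈ 𝔞_k` (a toric
function WITH ITS OWN BDP companion at the same existential period pair — Castella–Wan Thm 2.11 + Cor 2.12 shape at the additive 3;
the handed `(ΩK, Ωp, L)` stay hypotheses = existence insurance only), and `AdditiveSplitIMCInclusionAtThree_of` moves from `L♮` to
the handed `L` by the LANDED cross-period rigidity theorem `…Theorems.UniversalToricDescentTwinSplit.span_singleton_eq_of_isBDPLFunction`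
(utd-p2 p536114; import `…Theorems.UniversalToricDescentBDPFrameCrossPeriodRigidity`): `Ideal.span {L♮} = Ideal.span {L}`, then
`stub_descent … L₂ L♮`. No period torsor / parity calibration is left inside the research stub. rc 0 · 7 sorries = 7 stubs · `_of` BY NAME.
v4 = v4.2 ADOPTED by the lead cruxlead-20395 g3 (2026-08-29 06:2xZ): namespace `…ThinComb`, registered with
`ledger skeleton check`; the five carried stubs are byte-identical to v3 (landed: `stub_frame` p696267, `stub_charIdealPrincipal`
p692284, `stub_weakRigidity` p694324, `stub_descent` p700531; `stub_noPseudoNull` closed MODULO Greenberg 2016 Prop. 4.1.1 + Tate's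
global Euler characteristic at totally complex fields by `Theorems/UniversalToricDescentThinCombDescentNoPseudoNullOfFacts.lean`, p701674).
Open: `stub_toricTwoVarL` (research ∃), `stub_combDivisibility` (research ∀). Stubs v4 (7): `stub_frame`, `stub_charIdealPrincipal`,
`stub_toricTwoVarL`, `stub_combDivisibility`, `stub_weakRigidity`, `stub_noPseudoNull`, `stub_descent`.
v5 (lead cruxlead-20395 g3, 2026-08-29 06:5xZ, RESHAPE — typed split of K3 after utd-idea g46 S-g46-2/S-g46-3, evidence #47/#48):
the four LANDED stubs are no longer restated — `AdditiveSplitIMCInclusionAtThree_of` cites `UniversalToricDescentThinCombLine.stub_frame`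
(p696267), `.stub_charIdealPrincipal` (p692284), `.stub_weakRigidity` (p694324), `.stub_descent` (p700531) BY NAME — and the research
stub K3 `stub_toricTwoVarL` (v4) becomes the PROVED composition `toricTwoVarL_of_split` (u := 1, L♮ := spec (3^k) L₂; kernel congruence
`LineValue.sub_one_mul_map_spec_mem_lineIdeal`, p703286) of three registered stubs: K3a `stub_toricExists` (crux-research ∃: a toric
two-variable 3-adic L-function EXISTS at some period pair — the beyond-print content at the additive 3), K3b `stub_lineRestrictionIsBDP`
(any prime, PRINT = Castella–Wan Cor. 2.12: the central-ray restriction of a toric frame is a BDP frame at the same periods, GIVEN the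
Rankin–Selberg continuation — proved by the lead, `Theorems/…StubLineRestrictionIsBDP.lean`), K3c `stub_rankinSelbergContinuation`
(print-standard, unformalised: entire continuation of `L(f/K, φ, s)` for everywhere-unramified `φ` of type `(n, −n)`, Jacquet 1972
Thm. 19.14 / Shimura 1976 Thm. 2 — LOAD-BEARING: without it `IsBDPLFunction` prescribes the junk value `0` where the toric predicate
prescribes nothing). Stubs v5 (5 registered): `stub_toricExists` (research ∃), `stub_lineRestrictionIsBDP` (print, landing),
`stub_rankinSelbergContinuation` (print), `stub_combDivisibility` (research ∀), `stub_noPseudoNull` (print; closed modulo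
Greenberg2016.prop411 + Tate-EPC(TC), p701674).
v6 (lead cruxlead-20395 g4, 2026-08-29 08:3xZ, RESHAPE — K3c ELIMINATED). The Rankin–Selberg continuation (K3c, Jacquet 1972)
entered v5 only because `IsBDPLFunction` prescribes the JUNK value `0` at a character without continuation while the toric frame
prescribes nothing there. The handed frame `L` of the crux satisfies `IsBDPLFunction` unconditionally, so along the tree's
character supply `φ₀^{3^j}` EITHER the continuation fails infinitely often — then `L` has infinitely many zeros accumulating at
`T = 0`, `L = 0`, and the crux's inclusion is `⊥ ≤ _` — OR it holds cofinally, and cn100's LEMMA R∞ run on VALUES along the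
shifted supply gives `Ideal.span {spec (3^k) L₂} = Ideal.span {L}` (lead g4, `Theorems/UniversalToricDescentThinCombContRigidity.lean`,
`ContRigidity.eq_zero_or_span_spec_eq_of_toric`, any prime, sorry-free, no named fact). Hence `_of` no longer uses K3b's
continuation hypothesis nor K3c: stubs v6 (3 registered): `stub_toricExists` (K3a; PRINT-ADJACENT per `K3A-PRINT-STATUS-g4.md`:
Hida 1988 AIF Thm 5.1b gives the 𝛉-dominant measure for a FIXED supercuspidal-at-p form, `E_p = 1`, `p ≥ 5`; gap at 3 =
adaptation), `stub_combDivisibility` (K2⁺ ⊕ K4 ⊕ torsion — THE WALL: Beilinson–Flach explicit reciprocity at the supercuspidal 3,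
Wan arXiv:1607.07729 p. 7), `stub_noPseudoNull` (print; closed modulo Greenberg2016.prop411 ALONE — Tate-EPC(TC) is PROVED in the tree,
`forall_tateGlobalEulerPoincareCharacteristic_of_isTotallyComplex`; `…ClosedModuloV6.stub_noPseudoNull_of_prop411`, p707629). Landed and
cited by name: `stub_frame` p696267, `stub_charIdealPrincipal` p692284, `stub_weakRigidity` p694324, `stub_descent` p700531,
`LineValue` p703286, `ContRigidity` (this reshape); `stub_lineRestrictionIsBDP` p704137 stays in the tree (K3b, any prime) but is
no longer on the composition's path.
v7 (lead cruxlead-20395 g4, 2026-08-29 10:0xZ, RESHAPE — TORSION DICHOTOMY). In v1–v6 the research stub asserted `X₂` is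
`Λ₂`-torsion (at THE WALL this is Euler-system-grade, like K2⁺). v7 removes it from `stub_combDivisibility` by a case split in `_of`:
if `X₂` IS torsion the v6 descent runs verbatim; if NOT, the new registered stub `stub_torsionTransfer` (print-adjacent, L: Greenberg
control of `Sel_{∅,0}` from `K_∞^{ac}` to `K̃_∞` has kernel and cokernel cofinitely generated over `ℤ₃` — restriction is injective as
`E(K̃_∞)[3] = 0`, the cokernel is bounded by the local terms at `w ∣ 3N`, finitely many places, each cofinitely generated over `ℤ₃`
— hence `Λ`-cotorsion, so `rank_Λ X_ac = rank_Λ (X₂/𝔞_k X₂) ≥ rank_{Λ₂} X₂` by semicontinuity of rank under specialisation at the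
height-one prime `𝔞_k`) transfers non-torsion to `X_ac`, and then the crux's inclusion holds VACUOUSLY (`Ch_Λ(X_ac) = ⊤`: tree theorem
`UniversalToricDescentCharIdealVacuity.span_le_map_charIdeal_of_not_isTorsion`, utd-p1 p543904). Stubs v7 (4 registered ≤ 7):
`stub_toricExists` (K3a, print-adjacent), `stub_torsionTransfer` (NEW, print-adjacent control + algebra), `stub_combDivisibility` (v7:
∃ weak reflection ρ with `ρ G ∼ G` (K4), `ρ L₂ ∼ L₂` (K3(iii)), `ThinCombDvdInt R₀ 3 G L₂` (K2⁺) — THE WALL, no torsion clause),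
`stub_noPseudoNull` (⇐ Greenberg 2016 Prop. 4.1.1 alone, p707629).
v8 (lead cruxlead-20395 g5, 2026-08-29): `stub_torsionTransfer` PROVED AND LANDED (p723778; kernel, no named fact:
`Theorems/UniversalToricDescentAdditiveSplitIMCInclusionAtThreeStubTorsionTransfer.lean` — control image for the non-coordinate line,
Cayley–Hamilton killing at `𝔭′` in place of Serre's vanishing, Brink's decomposition element, the integer of the away discrepancy, and
the determinant trick on the `α_{3^k}`-twist) and cited BY NAME in `_of`. Stubs v8 (3 registered): `stub_toricExists` (K3a,
print-adjacent), `stub_combDivisibility` (THE WALL), `stub_noPseudoNull` (⇐ Greenberg 2016 Prop. 4.1.1).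
v8.1 (lead cruxlead-20395 g7, 2026-08-29; signatures and `_of` UNCHANGED, status of `stub_noPseudoNull` re-labelled): the stub no
longer rests on Greenberg 2016 Prop. 4.1.1 BY NAME. At the wall's instance `H²(K_Σ/K, 𝐃) = 0` (squeeze ⇒ corank 0, Prop. 3.2 from
Tate (TC) ⇒ cotorsion, `cd_p ≤ 2` (Harari 17.13 (a), tree theorem at totally complex `K`) ⇒ divisible ⇒ zero), so Greenberg 2006
Prop. 6.10 runs with `Σ' = ∅` and yields (α) and «`Ш²(K, Σ, 𝐃[π]) = 0` a.a. `Π`» WITHOUT [Gr4] Props. 5.2 / 6.3 / Thm. 1 (i)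
(`Literature/…/Greenberg2016/GlobalH1AlmostDivisibleOfHTwoVanishing.lean` p727850, `…/SelmerAlmostDivisibleCaseCOfHTwoVanishing.lean`
p728036), and [Gr5] Prop. 3.2.1 (c) at totally complex `K` is the cell `bsd-eis` road «SUR-Λ» modulo the ONE textbook fact
`GaloisCohomology.poitouTate_shaRestricted_tateDual_natural_at` (Milne ADT I Thm. 4.10 (a), finite `S`, totally complex):
`Theorems/UniversalToricDescentThinCombNoPseudoNullOfPoitouTate.lean` — `stub_noPseudoNull_of_poitouTateAt hX : (this stub, verbatim)`.
-/

set_option linter.dupNamespace false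
set_option autoImplicit false

noncomputable section

open NumberField IsDedekindDomain Field
open Literature.NumberTheory.EllipticCurves Literature.NumberTheory.GaloisRepresentations
open Summit.BirchSwinnertonDyer.BirchSwinnertonDyer.Theorems.UniversalToricDescentThinComb

namespace Summit.BirchSwinnertonDyer.BirchSwinnertonDyer.Cruxes.AdditiveSplitIMCInclusionAtThree.ThinComb

/-- **K3a `stub_toricExists`** (∃, L–XL; v5 statement, v6 LABEL: PRINT-ADJACENT — `K3A-PRINT-STATUS-g4.md`): in a v2 frame a
two-variable toric `𝔭`-adic `L`-function `L₂ ∈ Λ₂(R₀)` of `f = Dt.f` over the `ℤ₃²`-tower EXISTS at SOME admissible period pair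
`(Ω_K′ ≠ 0, Ω_p′ ≠ 0)` — Castella–Wan Thm. 2.11 shape (`IsToricTwoVarLFunction`, D1 p697787), no BDP companion, no congruence.
[cite: CastellaWan2023, §2.4 Thm. 2.11 (arXiv:1607.02019)] [cite: Hida1988AIF, §5 Example b, Lemma 5.2 (ii), Thm. 5.1b (doi:10.5802/aif.1141)]
In print modulo assembly for `p ≥ 5`: Hida's 𝛉-dominant measure `D_g` for a FIXED primitive `g` of conductor `J p^δ` INCLUDING
supercuspidal `π_{g,p}` (Euler `p`-factor `E(s) = 1`, matching D1's level-read factor `1` at additive `p`), times the CM-side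
renormalisation of CW Thm. 2.11 «Moreover» (Hida–Tilouine congruence module = anticyclotomic Katz `L`; `f`-level independent).
Why it might still fail AT THREE: Hida 1988 has the standing hypothesis `p ≥ 5` (ordinary `Λ`-adic duality); the `p = 3` case is an
ADAPTATION (neat auxiliary level), unwritten; the supercuspidal type of `f` at `p` is NOT an obstruction (the `f`-side enters only
through the arithmetic measure `μ_g(φ) = Σ φ(n) b(n) qⁿ`, no stabilisation). -/
theorem stub_toricExists :
    ∀ (W : WeierstrassCurve ℚ) [W.IsElliptic] [W.IsGloballyMinimal] (N : ℕ) [NeZero N] (K : Type) [Field K]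
      [NumberField K] (Dt : Literature.NumberTheory.EllipticCurves.ModularForms.ModularParametrizationData W N),
    Summit.BirchSwinnertonDyer.Rank1Residual.Additive.ClassO6 W 3 → W.HasSurjectiveModNGaloisRep 3 →
    W.analyticRank = 1 → W.conductorNorm ℤ = N → IsImaginaryQuadratic K → SatisfiesHeegnerHypothesis N K →
    ∀ (κ : ZpExtension K 3), κ.IsAnticyclotomic → ∀ (γ : Field.absoluteGaloisGroup K) [Fact (κ.IsTopGenerator γ)]
      (𝔭 : HeightOneSpectrum (𝓞 K)), ((3 : ℕ) : 𝓞 K) ∈ 𝔭.asIdeal →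
      𝔭.asIdeal.ramificationIdx (𝓞 ℚ) = 1 → 𝔭.asIdeal.inertiaDeg (𝓞 ℚ) = 1 →
    ∀ (𝔭' : HeightOneSpectrum (𝓞 K)), ((3 : ℕ) : 𝓞 K) ∈ 𝔭'.asIdeal → 𝔭' ≠ 𝔭 →
    ∀ (ι' : PadicAlgCl 3 ≃+* ℂ), Summit.BirchSwinnertonDyer.BirchSwinnertonDyer.Theorems.SchneiderFree.BranchInducesPrime 3 ι' 𝔭 →
    ∀ (κ₁ κ₂ : ZpExtension K 3) (γ₁ γ₂ : Field.absoluteGaloisGroup K) (k : ℕ)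
      [Fact (ZpExtension.IsTopGeneratorPair κ₁ κ₂ γ₁ γ₂)],
    (∀ v : HeightOneSpectrum (𝓞 K), v ≠ 𝔭 → ∀ 𝔓 ∈ v.primesAbove,
        𝔓.inertia (Field.absoluteGaloisGroup K) ≤ κ₁.kerSubgroup) →
    ZpExtension.pairKer κ₁ κ₂ ≤ κ.kerSubgroup → γ₁ * γ⁻¹ ∈ κ.kerSubgroup → γ₂ * (γ ^ (3 ^ k))⁻¹ ∈ κ.kerSubgroup →
    ∃ (ΩK' : ℂ) (Ωp' : ℂ_[3]) (L₂ : PowerSeries (PowerSeries (unrIntegers 3))),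
      ΩK' ≠ 0 ∧ Ωp' ≠ 0 ∧ IsToricTwoVarLFunction ι' 𝔭 𝔭' κ₁ κ₂ γ₁ γ₂ Dt.f ΩK' Ωp' L₂ := by
  sorry

/-- **stub_combDivisibility** (K2⁺ ⊕ K4 ⊕ K3(iii), crux-research ∀, XL — THE WALL; v7: the `Λ₂`-torsion clause of v4–v6 is
GONE, see `stub_torsionTransfer`): in a v2 frame, for every two-variable function `L₂` PINNED by `IsToricTwoVarLFunction`, there is a
WEAK REFLECTION `ρ` (fixes constants, `ρ T₂ ∉ (3, T₂)`; meant `c∘ι`, which qualifies because `cγ₂c` spans the `𝔭`-inertia line ≠ the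
`𝔭′`-line) with `ρ G ∼ G` (K4 — in print for every `E`: Nekovář 2006 Greenberg duality + transport by `c`), `ρ L₂ ∼ L₂` (K3(iii): the
functional equation of the PINNED `L₂`, unit root number factor) and INTEGRAL thin-comb divisibility `ThinCombDvdInt R₀ 3 G L₂`
(`L₂ ∈ (G, E_m(T₂))` on levels of unbounded order: `𝔭`-branch Beilinson–Flach classes per 3-power twist, 𝛉-dominant explicit
reciprocity at the SUPERCUSPIDAL 3, slack-free Λ-adic Kolyvagin bound — BEYOND PRINT: Wan arXiv:1607.07729 p. 7 «In the
non-crystalline case it seems very hard to work out such a big regulator map»; why it might fail: no reciprocity law at supercuspidal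
`p ∣ N` in print, and the slack-free bound may hold on no level — then only the rational door (24207 `RationalSplitIMCInclusionAtThree`,
thin_comb with bounded 3-slack) remains). VACUITY NOTE: if no `L₂` satisfies the predicate this stub is vacuous and ALL the weight
sits on `stub_toricExists`.
K2(b) RE-CUT (lead g5, adopting utd-idea g48 `Ideas/unramified-regulator.md`; the Lean signature is UNCHANGED — the tree has no
`H¹_Iw`, so the cut lives in the proof plan): the explicit-reciprocity sub-item K2(b) («𝛉-dominant law on comb lines needs a KLZ big
regulator for non-crystalline `V_f` — beyond print») SPLITS into K2(b-loc) ∧ K2(b-val). K2(b-loc) [ELEMENTARY, print + tree]: on tooth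
`m` the Hodge–Tate twist is constant (`j = 0` twisted by the fixed `ε_m`) and the regulator prime `𝔭′` is UNRAMIFIED in `K_{𝔭^∞}`, so the
`𝛉`-dominant Coleman map is `lim← ⅓·log_Ê(3·)`, an integral injection `H¹_{f,Iw}(L_m F_∞, T₃E)^{(ε_m)} ↪ Λ_U[ζ_{3^{m+1}}]` with cokernel
exponent `t_m = O(m) + c(E)`, `c(E) ≤ v₃(|E(ℚ₃^{ur})[3^∞]|·|Φ_E[3]|)` (Honda-integral `log`/`exp` of the additive curve: tree
`Rank1Residual.Additive.norm_coeff_formalLog_baseChange_le_one_of_addv` / `…formalExp…`; g48 Sketch §1–§2 rc 0; next typed lemma: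
«`Addv W 3`, `F/ℚ₃` unramified ⟹ `log_{W⊗F} : Ê(3𝒪_F) ⥲ 3𝒪_F`»). K2(b-val) [OPEN — the research kernel of K2, beyond print]: the
p-adic Beilinson formula `⟨log BF_{(f_E⊗ε_m, θ_λ), j=0}, ω_f ⊗ η_{θ_λ}⟩ = (c-factor)(CM Euler factors)·L_p^{Hida}(𝐠^{(𝔭)}, f_E⊗ε_m)(λ)`
for ordinary CM `θ_λ` of weight `≥ 2` at `p = 3 ∣ N` ([KLZ15] proves it for `p ∤ N` only; engines: cards `stable-fibre-regulator`,
`fern-reciprocity`). CURRENCY: K2(a) + K2(b-loc) + K2(b-val) + K2(c) deliver per-tooth divisibility WITH slack `3^{t_m}`, i.e. the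
RATIONAL `ThinCombDvdRat` consumed by `stub_ratCombSupply` of the rational wall (stmt-BirchSwinnertonDyer-24207); the INTEGRAL
`ThinCombDvdInt` demanded HERE additionally needs the slack removed on a cofinal set of teeth (`t_m = c(E)`-part: `E(ℚ₃^{ur})[3] = 0 ∧
3 ∤ |Φ_E|`; the `O(m)` idempotent denominator and K2(c)'s error term have no remover in print) — this residue IS the μ/unit-pinning
content of the integral wall (RK-6) and is why this stub stays crux-research. -/
theorem stub_combDivisibility :
    ∀ (W : WeierstrassCurve ℚ) [W.IsElliptic] [W.IsGloballyMinimal] (N : ℕ) [NeZero N] (K : Type) [Field K]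
      [NumberField K] (Dt : Literature.NumberTheory.EllipticCurves.ModularForms.ModularParametrizationData W N),
    Summit.BirchSwinnertonDyer.Rank1Residual.Additive.ClassO6 W 3 → W.HasSurjectiveModNGaloisRep 3 →
    W.analyticRank = 1 → W.conductorNorm ℤ = N → IsImaginaryQuadratic K → SatisfiesHeegnerHypothesis N K →
    ∀ (𝔭 : HeightOneSpectrum (𝓞 K)), ((3 : ℕ) : 𝓞 K) ∈ 𝔭.asIdeal →
      𝔭.asIdeal.ramificationIdx (𝓞 ℚ) = 1 → 𝔭.asIdeal.inertiaDeg (𝓞 ℚ) = 1 →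
    ∀ (𝔭' : HeightOneSpectrum (𝓞 K)), ((3 : ℕ) : 𝓞 K) ∈ 𝔭'.asIdeal → 𝔭' ≠ 𝔭 →
    ∀ (ι' : PadicAlgCl 3 ≃+* ℂ), Summit.BirchSwinnertonDyer.BirchSwinnertonDyer.Theorems.SchneiderFree.BranchInducesPrime 3 ι' 𝔭 →
    ∀ (κ₁ κ₂ : ZpExtension K 3) (γ₁ γ₂ : Field.absoluteGaloisGroup K)
      [Fact (ZpExtension.IsTopGeneratorPair κ₁ κ₂ γ₁ γ₂)],
    (∀ v : HeightOneSpectrum (𝓞 K), v ≠ 𝔭 → ∀ 𝔓 ∈ v.primesAbove,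
        𝔓.inertia (Field.absoluteGaloisGroup K) ≤ κ₁.kerSubgroup) →
    ∀ (g : IwasawaAlgebra₂ 3),
      Literature.NumberTheory.EllipticCurves.Module.charIdeal (IwasawaAlgebra₂ 3)
        ((W.baseChange K).XGr₂ 3 κ₁ κ₂ 𝔭' γ₁ γ₂) = Ideal.span {g} →
    ∀ (ΩK : ℂ) (Ωp : ℂ_[3]) (L₂ : PowerSeries (PowerSeries (unrIntegers 3))), ΩK ≠ 0 → Ωp ≠ 0 →
      IsToricTwoVarLFunction ι' 𝔭 𝔭' κ₁ κ₂ γ₁ γ₂ Dt.f ΩK Ωp L₂ →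
    ∃ (ρ : PowerSeries (PowerSeries (unrIntegers 3)) ≃+* PowerSeries (PowerSeries (unrIntegers 3))),
      (∀ c : unrIntegers 3, ρ (const (unrIntegers 3) c) = const (unrIntegers 3) c) ∧
      ρ (T₂ (unrIntegers 3)) ∉ Ideal.span {const (unrIntegers 3) ((3 : ℕ) : unrIntegers 3), T₂ (unrIntegers 3)} ∧
      Associated (ρ (PowerSeries.map (PowerSeries.map
        (Summit.BirchSwinnertonDyer.Rank1Residual.X11b.Halves.toUnr 3)) g))
        (PowerSeries.map (PowerSeries.map (Summit.BirchSwinnertonDyer.Rank1Residual.X11b.Halves.toUnr 3)) g) ∧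
      Associated (ρ L₂) L₂ ∧
      ThinCombDvdInt (unrIntegers 3) 3
        (PowerSeries.map (PowerSeries.map (Summit.BirchSwinnertonDyer.Rank1Residual.X11b.Halves.toUnr 3)) g) L₂ := by
  sorry

/-- **stub_noPseudoNull** (support, in print, L; v3 — NEW): in a v2 frame, if `X₂ = X_{∅ at 𝔭, nr at 𝔭′}(E/K̃_∞)`
is finitely generated and torsion over `Λ₂ = ℤ₃⟦T₂⟧⟦T₁⟧`, then every PSEUDO-NULL `Λ₂`-submodule of `X₂` is FINITE
(Greenberg's «`S` almost divisible ⟺ its dual has no non-zero pseudo-null submodule», a fortiori the S3n′ shape used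
by the tree's `PrintCf2.TwoVarSpecializationFinite` / `SignedBaseChangeAcDivSpecialization.S2`). CLOSED MODULO ONE named fact:
`…ThinCombLine.stub_noPseudoNull_of_prop411 : Greenberg2016.prop411_selmer_isAlmostDivisible → (this statement)` (p707629; the
Tate–Poitou Euler characteristic input of p701674 is the tree THEOREM `forall_tateGlobalEulerPoincareCharacteristic_of_isTotallyComplex`);
v8.1 (lead g7): CLOSED MODULO ONE TEXTBOOK fact instead — `NoPseudoNullOfPoitouTate.stub_noPseudoNull_of_poitouTateAt :
(∀ L [IsTotallyComplex L] S, S.Finite → GaloisCohomology.poitouTate_shaRestricted_tateDual_natural_at L S) → (this statement)`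
(Milne ADT I Thm. 4.10 (a); `H²(K_Σ/K, 𝐃) = 0` at the instance makes Prop. 6.10 run with `Σ' = ∅`). In print: Greenberg
2016 Prop. 4.1.1 (RFX, LEO, LOC⁽²⁾ for twist deformations §4.3; LOC⁽¹⁾ at a prime not split completely in `K̃_∞`;
`𝓛` almost divisible: no condition above `𝔭`, unramified above `𝔭′`; CRK from torsion; (a) `E(K̃_∞)[3] = 0` from
`ρ̄` onto) + the Shapiro descent `S_𝓛(K, T ⊗ Λ₂) ≅ Sel(K̃_∞)` (Greenberg §4.3 p. 21, «[Gr6]»); the tree holds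
Prop. 4.1.1 as the named fact `Greenberg2016.prop411_selmer_isAlmostDivisible`. Why it might fail: the unramified
local condition above the ADDITIVE prime `𝔭′ ∣ 3` must be almost `Λ₂`-divisible (Prop. 4.2.2 needs `H²(K_η, C_η) = 0`
for a coreflexive `C_η`); not checked in print at potentially supersingular wild `3`. -/
theorem stub_noPseudoNull :
    ∀ (W : WeierstrassCurve ℚ) [W.IsElliptic] [W.IsGloballyMinimal] (K : Type) [Field K] [NumberField K],
    Summit.BirchSwinnertonDyer.Rank1Residual.Additive.ClassO6 W 3 → W.HasSurjectiveModNGaloisRep 3 →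
    IsImaginaryQuadratic K →
    ∀ (κ : ZpExtension K 3), κ.IsAnticyclotomic → ∀ (γ : Field.absoluteGaloisGroup K) [Fact (κ.IsTopGenerator γ)]
      (𝔭 : HeightOneSpectrum (𝓞 K)), ((3 : ℕ) : 𝓞 K) ∈ 𝔭.asIdeal →
    ∀ (𝔭' : HeightOneSpectrum (𝓞 K)), ((3 : ℕ) : 𝓞 K) ∈ 𝔭'.asIdeal → 𝔭' ≠ 𝔭 →
    ∀ (κ₁ κ₂ : ZpExtension K 3) (γ₁ γ₂ : Field.absoluteGaloisGroup K) (k : ℕ)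
      [Fact (ZpExtension.IsTopGeneratorPair κ₁ κ₂ γ₁ γ₂)],
    (∀ v : HeightOneSpectrum (𝓞 K), v ≠ 𝔭 → ∀ 𝔓 ∈ v.primesAbove,
        𝔓.inertia (Field.absoluteGaloisGroup K) ≤ κ₁.kerSubgroup) →
    ZpExtension.pairKer κ₁ κ₂ ≤ κ.kerSubgroup → γ₁ * γ⁻¹ ∈ κ.kerSubgroup → γ₂ * (γ ^ (3 ^ k))⁻¹ ∈ κ.kerSubgroup →
    Module.Finite (IwasawaAlgebra₂ 3) ((W.baseChange K).XGr₂ 3 κ₁ κ₂ 𝔭' γ₁ γ₂) →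
    Module.IsTorsion (IwasawaAlgebra₂ 3) ((W.baseChange K).XGr₂ 3 κ₁ κ₂ 𝔭' γ₁ γ₂) →
    ∀ N : Submodule (IwasawaAlgebra₂ 3) ((W.baseChange K).XGr₂ 3 κ₁ κ₂ 𝔭' γ₁ γ₂),
      Literature.NumberTheory.EllipticCurves.Module.IsPseudoNull (IwasawaAlgebra₂ 3) N → Finite N := by
  sorry

/-- **Composition** (kernel-checked, no `sorry` outside the stubs; v7): the four registered stubs, the four landed stub
theorems and the landed helpers `LineValue` / `ContRigidity` (by name) give the crux BY NAME. The handed BDP frame `L` is either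
`0` (crux trivially) or generates the same ideal as the central-ray restriction `spec (3^k) L₂` of K3a's toric function
(`ContRigidity.eq_zero_or_span_spec_eq_of_toric` — no Rankin–Selberg continuation needed). -/
theorem AdditiveSplitIMCInclusionAtThree_of :
    Summit.BirchSwinnertonDyer.BirchSwinnertonDyer.Theses.UniversalToricDescent.AdditiveSplitIMCInclusionAtThree := by
  intro W _ _ N _ K _ _ Dt hO6 hsurj hrk hN hK hH κ hκ γ hγ 𝔭 h3 hram hdeg 𝔭' h3' hne ι' hι ΩK Ωp L hΩK hΩp hL
  obtain ⟨κ₁, κ₂, γ₁, γ₂, k, hpair, hur₁, hker, hγ₁, hγ₂⟩ :=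
    Summit.BirchSwinnertonDyer.BirchSwinnertonDyer.Theorems.UniversalToricDescentThinCombLine.stub_frame K hK κ hκ γ hγ.out 𝔭 h3 𝔭' h3' hne
  haveI : Fact (ZpExtension.IsTopGeneratorPair κ₁ κ₂ γ₁ γ₂) := ⟨hpair⟩
  obtain ⟨g, hg⟩ :=
    (Summit.BirchSwinnertonDyer.BirchSwinnertonDyer.Theorems.UniversalToricDescentThinCombLine.stub_charIdealPrincipal ((W.baseChange K).XGr₂ 3 κ₁ κ₂ 𝔭' γ₁ γ₂))
  have hg' : Literature.NumberTheory.EllipticCurves.Module.charIdeal (IwasawaAlgebra₂ 3)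
      ((W.baseChange K).XGr₂ 3 κ₁ κ₂ 𝔭' γ₁ γ₂) = Ideal.span {g} := by
    simpa [Ideal.submodule_span_eq] using hg
  have hfin : Module.Finite (IwasawaAlgebra₂ 3) ((W.baseChange K).XGr₂ 3 κ₁ κ₂ 𝔭' γ₁ γ₂) :=
    Summit.BirchSwinnertonDyer.BirchSwinnertonDyer.Theorems.SignedBaseChangeAcDivFinitePiece.xGr₂_module_finite
      (W.baseChange K) 3 κ₁ κ₂ 𝔭'
  -- K3a: a toric two-variable function at some period pair
  obtain ⟨ΩK', Ωp', L₂, hΩK', hΩp', hL₂⟩ :=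
    stub_toricExists W N K Dt hO6 hsurj hrk hN hK hH κ hκ γ 𝔭 h3 hram hdeg 𝔭' h3' hne ι' hι κ₁ κ₂ γ₁ γ₂ k
      hur₁ hker hγ₁ hγ₂
  -- cross-period rigidity WITHOUT the Rankin–Selberg continuation (lead g4): `L = 0` or `(spec L₂) = (L)`
  rcases Summit.BirchSwinnertonDyer.BirchSwinnertonDyer.Theorems.UniversalToricDescentThinComb.ContRigidity.eq_zero_or_span_spec_eq_of_toric
      K N Dt.f hK κ hκ γ hγ.out 𝔭 h3 𝔭' h3' hne ι' κ₁ κ₂ γ₁ γ₂ k hpair hγ₁ hγ₂ hΩK hΩp hL hΩK' hΩp' hL₂ with h0 | hspan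
  · rw [h0, Ideal.span_singleton_eq_bot.mpr rfl]
    exact bot_le
  -- TORSION DICHOTOMY (v7): off the torsion locus of `X₂` the inclusion is vacuous
  by_cases htors : Module.IsTorsion (IwasawaAlgebra₂ 3) ((W.baseChange K).XGr₂ 3 κ₁ κ₂ 𝔭' γ₁ γ₂)
  swap
  · have hnt := Summit.BirchSwinnertonDyer.BirchSwinnertonDyer.Theorems.UniversalToricDescentThinCombLine.stub_torsionTransfer
      W K hO6 hsurj hK κ hκ γ 𝔭 h3 𝔭' h3' hne κ₁ κ₂ γ₁ γ₂ k hur₁ hker hγ₁ hγ₂ htors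
    exact Summit.BirchSwinnertonDyer.BirchSwinnertonDyer.Theorems.UniversalToricDescentCharIdealVacuity.span_le_map_charIdeal_of_not_isTorsion
      hnt _ L
  have hcong : ∃ u : (PowerSeries (PowerSeries (unrIntegers 3)))ˣ,
      L₂ - u * PowerSeries.map (PowerSeries.C (R := unrIntegers 3)) (TwoVarSubst.spec (3 ^ k) L₂) ∈
        Ideal.span {T₂ (unrIntegers 3) - ((1 + T₁ (unrIntegers 3)) ^ (3 ^ k) - 1)} :=
    ⟨1, LineValue.sub_one_mul_map_spec_mem_lineIdeal (3 ^ k) L₂⟩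
  obtain ⟨ρ, hρc, hρT, hGsym, hLsym, hcomb⟩ :=
    stub_combDivisibility W N K Dt hO6 hsurj hrk hN hK hH 𝔭 h3 hram hdeg 𝔭' h3' hne ι' hι κ₁ κ₂ γ₁ γ₂
      hur₁ g hg' ΩK' Ωp' L₂ hΩK' hΩp' hL₂
  have hdvd := Summit.BirchSwinnertonDyer.BirchSwinnertonDyer.Theorems.UniversalToricDescentThinCombLine.stub_weakRigidity ρ hρc hρT _ L₂ hGsym hLsym hcomb
  have hPN := stub_noPseudoNull W K hO6 hsurj hK κ hκ γ 𝔭 h3 𝔭' h3' hne κ₁ κ₂ γ₁ γ₂ k hur₁ hker hγ₁ hγ₂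
    hfin htors
  rw [← hspan]
  exact Summit.BirchSwinnertonDyer.BirchSwinnertonDyer.Theorems.UniversalToricDescentThinCombLine.stub_descent W K hO6 hsurj hK κ hκ γ 𝔭 h3 𝔭' h3' hne κ₁ κ₂ γ₁ γ₂ k hur₁ hker
    hγ₁ hγ₂ hfin htors hPN
    g hg' L₂ (TwoVarSubst.spec (3 ^ k) L₂) hdvd hcong

end Summit.BirchSwinnertonDyer.BirchSwinnertonDyer.Cruxes.AdditiveSplitIMCInclusionAtThree.ThinComb

end
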